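import Summits.CriticalPhenomena.PercolationContinuityZ3.Theorems.PercNearOneGluingNoHeavyLowerTailMajorityGluingQCert3Range
import HarnessLib

/-!
# A leaner kernel merge sort for the degree-3 range checks (lane prim-rate, constants-miner 1, gen 34; NEXT-g35 item 1)

Support file for the closed crux `NoHeavyLowerTail` (stmt-CriticalPhenomena-4575), majority-gluing line; companion of `…QCertSort` / `…QCert3Range`.  `msortK` of
`…QCertSort` passes a fuel `= length` to every merge and recomputes `List.length` at every node of the recursion; here `merge2` recurses structurally on the first list with
an inner structural recursion on the second (no fuel, no length), and `msort2` keeps only the depth fuel.  Same soundness route (`msort2_perm`, `runsOK`), and the range check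
`Cert3.checkQ3R2` with its step lemma `Cert3.evalC_rest_step2`, interchangeable with `checkQ3R`.  Pure list arithmetic; no sorries. [folklore]
-/

namespace Summit.CriticalPhenomena.PercolationContinuityZ3.Theorems

namespace HubOnly
namespace QCert

/-- Inner merge loop: insert the fixed head `a` against the second list, continuing with `k` (the merge of the first list's tail). -/
def merge2Aux (a : ℕ × ℤ) (k : List (ℕ × ℤ) → List (ℕ × ℤ)) : List (ℕ × ℤ) → List (ℕ × ℤ)
  | [] => a :: k []
  | b :: l₂ => if a.1 ≤ b.1 then a :: k (b :: l₂) else b :: merge2Aux a k l₂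

/-- Structural two-list merge by key. -/
def merge2 : List (ℕ × ℤ) → List (ℕ × ℤ) → List (ℕ × ℤ)
  | [], l₂ => l₂
  | a :: l₁, l₂ => merge2Aux a (merge2 l₁) l₂

/-- Merge sort by key with depth fuel only. -/
def msort2 : ℕ → List (ℕ × ℤ) → List (ℕ × ℤ)
  | 0, l => l
  | _ + 1, [] => []
  | _ + 1, [a] => [a]
  | f + 1, a :: b :: l => merge2 (msort2 f (a :: (splitAlt l).1)) (msort2 f (b :: (splitAlt l).2))

/-- `merge2Aux a k l₂ ~ a :: (? ++ l₂)` when `k l ~ l₁ ++ l` for all `l`. -/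
theorem merge2Aux_perm (a : ℕ × ℤ) (l₁ : List (ℕ × ℤ)) (k : List (ℕ × ℤ) → List (ℕ × ℤ)) (hk : ∀ l, (k l).Perm (l₁ ++ l)) :
    ∀ l₂ : List (ℕ × ℤ), (merge2Aux a k l₂).Perm (a :: (l₁ ++ l₂))
  | [] => by rw [merge2Aux]; exact (hk []).cons a
  | b :: l₂ => by
    rw [merge2Aux]
    split_ifs
    · exact (hk (b :: l₂)).cons a
    · have h := (merge2Aux_perm a l₁ k hk l₂).cons b
      refine h.trans ?_
      have : (a :: (l₁ ++ b :: l₂)).Perm (b :: a :: (l₁ ++ l₂)) := by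
        have h1 : (l₁ ++ b :: l₂).Perm (b :: (l₁ ++ l₂)) := List.perm_middle
        exact (h1.cons a).trans (List.Perm.swap b a _)
      exact this.symm

/-- `merge2` is a permutation of the concatenation. -/
theorem merge2_perm : ∀ l₁ l₂ : List (ℕ × ℤ), (merge2 l₁ l₂).Perm (l₁ ++ l₂)
  | [], l₂ => by rw [merge2]; simp
  | a :: l₁, l₂ => by
    rw [merge2]
    exact merge2Aux_perm a l₁ (merge2 l₁) (merge2_perm l₁) l₂

/-- `msort2` is a permutation. -/
theorem msort2_perm : ∀ (f : ℕ) (l : List (ℕ × ℤ)), (msort2 f l).Perm l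
  | 0, l => by rw [msort2]
  | f + 1, [] => by rw [msort2]
  | f + 1, [a] => by rw [msort2]
  | f + 1, a :: b :: l => by
    rw [msort2]
    refine (merge2_perm _ _).trans ?_
    refine ((msort2_perm f _).append (msort2_perm f _)).trans ?_
    show (a :: ((splitAlt l).1 ++ b :: (splitAlt l).2)).Perm (a :: b :: l)
    exact (List.perm_middle.trans ((splitAlt_perm l).cons b)).cons a

noncomputable section

/-- **Sort-merge nonnegativity with `msort2`.** -/
theorem evalC_nonneg_of_runsOK_msort2 (val : ℕ → ℝ) (hval : ∀ i, 0 ≤ val i) (fuel : ℕ) (l : List (ℕ × ℤ))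
    (h : runsOK (msort2 fuel l) = true) : 0 ≤ evalC val l := by
  rw [← evalC_perm val (msort2_perm fuel l)]
  exact evalC_nonneg_of_runsOK val hval _ h

namespace Cert3

variable (c : Cert3)

/-- **The range check with `msort2`** on the keys `lo ≤ key < hi`. -/
def checkQ3R2 (lo hi fuel : ℕ) : Bool := runsOK (msort2 fuel ((c.rest lo).filter fun e => decide (e.1 < hi)))

/-- **Range step for `checkQ3R2`:** a passing range `[lo, hi)` and a nonnegative remainder `rest hi` give a nonnegative `rest lo`. -/
theorem evalC_rest_step2 (val : ℕ → ℝ) (hval : ∀ i, 0 ≤ val i) (lo hi fuel : ℕ) (hle : lo ≤ hi) (hR : c.checkQ3R2 lo hi fuel = true)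
    (hrest : 0 ≤ evalC val (c.rest hi)) : 0 ≤ evalC val (c.rest lo) := by
  have hsplit := evalC_perm val (List.filter_append_perm (fun e : ℕ × ℤ => decide (e.1 < hi)) (c.rest lo))
  rw [evalC_append] at hsplit
  have h1 : 0 ≤ evalC val ((c.rest lo).filter fun e => decide (e.1 < hi)) := evalC_nonneg_of_runsOK_msort2 val hval fuel _ hR
  have h2 : (c.rest lo).filter (fun e => !decide (e.1 < hi)) = c.rest hi := by
    unfold rest
    rw [List.filter_filter]
    refine List.filter_congr fun e _ => ?_
    by_cases h : hi ≤ e.1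
    · have : lo ≤ e.1 := le_trans hle h
      simp [h, this]
    · simp [h]
  rw [h2] at hsplit
  linarith

end Cert3

end

/-- Smoke test: the leaner sort agrees with the run scan on a small example. -/
theorem runsOK_msort2_example : runsOK (msort2 4 [(5, 2), (1, -3), (2, 3), (5, -4), (1, 3), (5, 3)]) = true := by decide +kernel

end QCert
end HubOnly

end Summit.CriticalPhenomena.PercolationContinuityZ3.Theorems
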